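import Summits.RiemannHypothesis.RiemannHypothesis.Theorems.SemilocalNegCertUptoNinetySevenKinkedB
import Summits.RiemannHypothesis.RiemannHypothesis.Theorems.SemilocalNegCertUptoNinetySevenKinkedC
import Summits.RiemannHypothesis.RiemannHypothesis.Theorems.SemilocalNegCertUptoNinetySevenKinkedD
import Summits.RiemannHypothesis.RiemannHypothesis.Theorems.SemilocalNegCertUptoNinetySevenKinkedE
import Summits.RiemannHypothesis.RiemannHypothesis.Theorems.SemilocalNegCertUptoNinetySevenKinkedF
import Summits.RiemannHypothesis.RiemannHypothesis.Theorems.SemilocalNegCertUptoNinetySevenKinkedG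
import HarnessLib

/-!
# Semi-local threshold of the `{∞} ∪ {p < 101}` form, negative side: `a*({2,…,97}) ≤ 593/256` — the TWIN-PRIME wall `q = 101` from a KINKED (piecewise-cubic) witness (part 6/7: the composition of the 244 piece facts)

Cell `rh-explicit` (HOME `run/shared/lean/pub/rh-explicit/`), seat cc-s2-4 gen11 (A4 SEMILOCAL-TABLE, kernel column; log of record
`HOME/cc-s2-4/CC4-LEAN.md` §16).  Honest framing: theorems about the tree's `weilSemilocalThreshold S`; nothing here bears on RH.
No data is trusted: every bound is a `decide +kernel` fact of the piecewise certificate `SemilocalPiecewiseCert.lean` (cc-s2-4 gen8).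

WHY (numbers; `HOME/cc-s2-4/gen10/kinked101/KINKED-101-NOTE.md`, `HOME/cc-s2-4/gen10/knee/KNEE-NOTE.md`): the RH-free upper clause of
the handoff programme at a prime `q` asks for `a*(S_q) < (log q⁺)/2`, a witness window within `½·log(q⁺/q)` of the wall `(log q)/2`.
At the twin prime `q = 101` (`q⁺ = 103`) that gap is `0.0098`; the odd-polynomial rows of `SemilocalNegCert*.lean` (degree ≤ 21,
certifiable knee ≈ `0.012` above the wall) reach only `Re Q/‖G‖² ≈ −1·10⁻⁹` at the last admissible window `593/256 = 2.31640625`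
(`(log 101)/2 = 2.30756`, `(log 103)/2 = 2.31736`), degree 33 only `−3·10⁻⁸`.  An odd PIECEWISE CUBIC with slope breaks at the
14 atom images `|b − log n|` nearest `0` (`n = 11, 9, 8, 13, 7, 16, 17, 19, 5, 23, 25, 4, 27, 29`, rounded to `/1024`) gives
`−2.29·10⁻⁴` (float finder `pwfind.py`, form without polar credit; all 35 kinks: `−1.07·10⁻¹`).  Instance: `S = {p ≤ 97}`, window
`N = 102` (`2b = 593/128 = 4.6328 < log 103 = 4.6347`), 35 atoms (enclosures `SemilocalLogAtoms{,B,…,I}.lean`), 15 pieces of degree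
≤ 3, orders `(10, 4, 8, 4, 10, 40)`, 244 `t`-pieces; kernel margin `(rhs − lhs)/‖G‖² = 2.29·10⁻⁴`.  ⇒ **`a*({2,…,97}) ≤ 593/256 <
(log 103)/2`**: the upper clause holds at `q = 101` too, and `δ*(101) < 0.00885`.  The instance is split for the gate into part 1
(table, certificate, `checkMainPW`, the atom side in kernel chunks of ≤ 4 atoms via `SemilocalPiecewiseCertSplit.lean`), parts 2–5
(68 piece facts each in the FLEX layout of `SemilocalPiecewiseCertFlex.lean` (cc-s2-4 gen12, CC4-LEAN §17.2): piece `0` by `checkPiecePW`,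
every far piece by `checkPieceFlex i ⟨n, m, K, m', u₀⟩` with the orders that piece needs (mean majorant degree ≈ 62 instead of 176) and a
short dyadic centre `u₀ ≤ u_K(T₀)` — same witness, same cuts, claims recomputed (`⌈exact⌉ + 1`), kernel margin `2.2877e-04`·‖G‖²; each
fact file imports part 1 only), the Pieces part (composition) and the Final part (theorems).  Folklore throughout.
-/

set_option autoImplicit false
set_option linter.dupNamespace false  -- the mandated namespace repeats `RiemannHypothesis`
set_option Elab.async false  -- serialise the kernel facts: in parallel they exhaust the node's per-process heap (cc-s2-4 gen11, CC4-LEAN §16.10)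

noncomputable section

open Complex Filter Set MeasureTheory Topology
open scoped Real

namespace Summit.RiemannHypothesis.RiemannHypothesis.Theorems.SemilocalPolyWitness

open MeasureTheory Set Finset Real
open Literature.NumberTheory.LFunctions
open Summit.RiemannHypothesis.RiemannHypothesis.Theorems.MotivicDoor
open Summit.RiemannHypothesis.RiemannHypothesis.Theorems.MotivicDoor.SemilocalThreshold
open Summit.RiemannHypothesis.RiemannHypothesis.Theorems.MotivicDoor.SemilocalMarkov
open LQ

set_option maxRecDepth 4000 in  -- `i < cuts.length` unfolds a 244-element list
/-- all pieces of `certUptoNinetySevenKinked` check (piece `0` with the global orders, the others in the FLEX form). -/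
theorem check_UptoNinetySevenKinked_pieces : ∀ i, i < certUptoNinetySevenKinked.cuts.length →
    certUptoNinetySevenKinked.checkPiecePW i = true ∨ ∃ o, certUptoNinetySevenKinked.checkPieceFlex i o = true := by
  intro i hi
  have hi' : i < 244 := hi
  interval_cases i
  · exact Or.inl check_UptoNinetySevenKinked_piece0
  · exact Or.inr ⟨_, check_UptoNinetySevenKinked_piece1⟩
  · exact Or.inr ⟨_, check_UptoNinetySevenKinked_piece2⟩
  · exact Or.inr ⟨_, check_UptoNinetySevenKinked_piece3⟩
  · exact Or.inr ⟨_, check_UptoNinetySevenKinked_piece4⟩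
  · exact Or.inr ⟨_, check_UptoNinetySevenKinked_piece5⟩
  · exact Or.inr ⟨_, check_UptoNinetySevenKinked_piece6⟩
  · exact Or.inr ⟨_, check_UptoNinetySevenKinked_piece7⟩
  · exact Or.inr ⟨_, check_UptoNinetySevenKinked_piece8⟩
  · exact Or.inr ⟨_, check_UptoNinetySevenKinked_piece9⟩
  · exact Or.inr ⟨_, check_UptoNinetySevenKinked_piece10⟩
  · exact Or.inr ⟨_, check_UptoNinetySevenKinked_piece11⟩
  · exact Or.inr ⟨_, check_UptoNinetySevenKinked_piece12⟩
  · exact Or.inr ⟨_, check_UptoNinetySevenKinked_piece13⟩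
  · exact Or.inr ⟨_, check_UptoNinetySevenKinked_piece14⟩
  · exact Or.inr ⟨_, check_UptoNinetySevenKinked_piece15⟩
  · exact Or.inr ⟨_, check_UptoNinetySevenKinked_piece16⟩
  · exact Or.inr ⟨_, check_UptoNinetySevenKinked_piece17⟩
  · exact Or.inr ⟨_, check_UptoNinetySevenKinked_piece18⟩
  · exact Or.inr ⟨_, check_UptoNinetySevenKinked_piece19⟩
  · exact Or.inr ⟨_, check_UptoNinetySevenKinked_piece20⟩
  · exact Or.inr ⟨_, check_UptoNinetySevenKinked_piece21⟩
  · exact Or.inr ⟨_, check_UptoNinetySevenKinked_piece22⟩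
  · exact Or.inr ⟨_, check_UptoNinetySevenKinked_piece23⟩
  · exact Or.inr ⟨_, check_UptoNinetySevenKinked_piece24⟩
  · exact Or.inr ⟨_, check_UptoNinetySevenKinked_piece25⟩
  · exact Or.inr ⟨_, check_UptoNinetySevenKinked_piece26⟩
  · exact Or.inr ⟨_, check_UptoNinetySevenKinked_piece27⟩
  · exact Or.inr ⟨_, check_UptoNinetySevenKinked_piece28⟩
  · exact Or.inr ⟨_, check_UptoNinetySevenKinked_piece29⟩
  · exact Or.inr ⟨_, check_UptoNinetySevenKinked_piece30⟩
  · exact Or.inr ⟨_, check_UptoNinetySevenKinked_piece31⟩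
  · exact Or.inr ⟨_, check_UptoNinetySevenKinked_piece32⟩
  · exact Or.inr ⟨_, check_UptoNinetySevenKinked_piece33⟩
  · exact Or.inr ⟨_, check_UptoNinetySevenKinked_piece34⟩
  · exact Or.inr ⟨_, check_UptoNinetySevenKinked_piece35⟩
  · exact Or.inr ⟨_, check_UptoNinetySevenKinked_piece36⟩
  · exact Or.inr ⟨_, check_UptoNinetySevenKinked_piece37⟩
  · exact Or.inr ⟨_, check_UptoNinetySevenKinked_piece38⟩
  · exact Or.inr ⟨_, check_UptoNinetySevenKinked_piece39⟩
  · exact Or.inr ⟨_, check_UptoNinetySevenKinked_piece40⟩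
  · exact Or.inr ⟨_, check_UptoNinetySevenKinked_piece41⟩
  · exact Or.inr ⟨_, check_UptoNinetySevenKinked_piece42⟩
  · exact Or.inr ⟨_, check_UptoNinetySevenKinked_piece43⟩
  · exact Or.inr ⟨_, check_UptoNinetySevenKinked_piece44⟩
  · exact Or.inr ⟨_, check_UptoNinetySevenKinked_piece45⟩
  · exact Or.inr ⟨_, check_UptoNinetySevenKinked_piece46⟩
  · exact Or.inr ⟨_, check_UptoNinetySevenKinked_piece47⟩
  · exact Or.inr ⟨_, check_UptoNinetySevenKinked_piece48⟩
  · exact Or.inr ⟨_, check_UptoNinetySevenKinked_piece49⟩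
  · exact Or.inr ⟨_, check_UptoNinetySevenKinked_piece50⟩
  · exact Or.inr ⟨_, check_UptoNinetySevenKinked_piece51⟩
  · exact Or.inr ⟨_, check_UptoNinetySevenKinked_piece52⟩
  · exact Or.inr ⟨_, check_UptoNinetySevenKinked_piece53⟩
  · exact Or.inr ⟨_, check_UptoNinetySevenKinked_piece54⟩
  · exact Or.inr ⟨_, check_UptoNinetySevenKinked_piece55⟩
  · exact Or.inr ⟨_, check_UptoNinetySevenKinked_piece56⟩
  · exact Or.inr ⟨_, check_UptoNinetySevenKinked_piece57⟩
  · exact Or.inr ⟨_, check_UptoNinetySevenKinked_piece58⟩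
  · exact Or.inr ⟨_, check_UptoNinetySevenKinked_piece59⟩
  · exact Or.inr ⟨_, check_UptoNinetySevenKinked_piece60⟩
  · exact Or.inr ⟨_, check_UptoNinetySevenKinked_piece61⟩
  · exact Or.inr ⟨_, check_UptoNinetySevenKinked_piece62⟩
  · exact Or.inr ⟨_, check_UptoNinetySevenKinked_piece63⟩
  · exact Or.inr ⟨_, check_UptoNinetySevenKinked_piece64⟩
  · exact Or.inr ⟨_, check_UptoNinetySevenKinked_piece65⟩
  · exact Or.inr ⟨_, check_UptoNinetySevenKinked_piece66⟩
  · exact Or.inr ⟨_, check_UptoNinetySevenKinked_piece67⟩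
  · exact Or.inr ⟨_, check_UptoNinetySevenKinked_piece68⟩
  · exact Or.inr ⟨_, check_UptoNinetySevenKinked_piece69⟩
  · exact Or.inr ⟨_, check_UptoNinetySevenKinked_piece70⟩
  · exact Or.inr ⟨_, check_UptoNinetySevenKinked_piece71⟩
  · exact Or.inr ⟨_, check_UptoNinetySevenKinked_piece72⟩
  · exact Or.inr ⟨_, check_UptoNinetySevenKinked_piece73⟩
  · exact Or.inr ⟨_, check_UptoNinetySevenKinked_piece74⟩
  · exact Or.inr ⟨_, check_UptoNinetySevenKinked_piece75⟩
  · exact Or.inr ⟨_, check_UptoNinetySevenKinked_piece76⟩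
  · exact Or.inr ⟨_, check_UptoNinetySevenKinked_piece77⟩
  · exact Or.inr ⟨_, check_UptoNinetySevenKinked_piece78⟩
  · exact Or.inr ⟨_, check_UptoNinetySevenKinked_piece79⟩
  · exact Or.inr ⟨_, check_UptoNinetySevenKinked_piece80⟩
  · exact Or.inr ⟨_, check_UptoNinetySevenKinked_piece81⟩
  · exact Or.inr ⟨_, check_UptoNinetySevenKinked_piece82⟩
  · exact Or.inr ⟨_, check_UptoNinetySevenKinked_piece83⟩
  · exact Or.inr ⟨_, check_UptoNinetySevenKinked_piece84⟩
  · exact Or.inr ⟨_, check_UptoNinetySevenKinked_piece85⟩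
  · exact Or.inr ⟨_, check_UptoNinetySevenKinked_piece86⟩
  · exact Or.inr ⟨_, check_UptoNinetySevenKinked_piece87⟩
  · exact Or.inr ⟨_, check_UptoNinetySevenKinked_piece88⟩
  · exact Or.inr ⟨_, check_UptoNinetySevenKinked_piece89⟩
  · exact Or.inr ⟨_, check_UptoNinetySevenKinked_piece90⟩
  · exact Or.inr ⟨_, check_UptoNinetySevenKinked_piece91⟩
  · exact Or.inr ⟨_, check_UptoNinetySevenKinked_piece92⟩
  · exact Or.inr ⟨_, check_UptoNinetySevenKinked_piece93⟩
  · exact Or.inr ⟨_, check_UptoNinetySevenKinked_piece94⟩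
  · exact Or.inr ⟨_, check_UptoNinetySevenKinked_piece95⟩
  · exact Or.inr ⟨_, check_UptoNinetySevenKinked_piece96⟩
  · exact Or.inr ⟨_, check_UptoNinetySevenKinked_piece97⟩
  · exact Or.inr ⟨_, check_UptoNinetySevenKinked_piece98⟩
  · exact Or.inr ⟨_, check_UptoNinetySevenKinked_piece99⟩
  · exact Or.inr ⟨_, check_UptoNinetySevenKinked_piece100⟩
  · exact Or.inr ⟨_, check_UptoNinetySevenKinked_piece101⟩
  · exact Or.inr ⟨_, check_UptoNinetySevenKinked_piece102⟩
  · exact Or.inr ⟨_, check_UptoNinetySevenKinked_piece103⟩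
  · exact Or.inr ⟨_, check_UptoNinetySevenKinked_piece104⟩
  · exact Or.inr ⟨_, check_UptoNinetySevenKinked_piece105⟩
  · exact Or.inr ⟨_, check_UptoNinetySevenKinked_piece106⟩
  · exact Or.inr ⟨_, check_UptoNinetySevenKinked_piece107⟩
  · exact Or.inr ⟨_, check_UptoNinetySevenKinked_piece108⟩
  · exact Or.inr ⟨_, check_UptoNinetySevenKinked_piece109⟩
  · exact Or.inr ⟨_, check_UptoNinetySevenKinked_piece110⟩
  · exact Or.inr ⟨_, check_UptoNinetySevenKinked_piece111⟩
  · exact Or.inr ⟨_, check_UptoNinetySevenKinked_piece112⟩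
  · exact Or.inr ⟨_, check_UptoNinetySevenKinked_piece113⟩
  · exact Or.inr ⟨_, check_UptoNinetySevenKinked_piece114⟩
  · exact Or.inr ⟨_, check_UptoNinetySevenKinked_piece115⟩
  · exact Or.inr ⟨_, check_UptoNinetySevenKinked_piece116⟩
  · exact Or.inr ⟨_, check_UptoNinetySevenKinked_piece117⟩
  · exact Or.inr ⟨_, check_UptoNinetySevenKinked_piece118⟩
  · exact Or.inr ⟨_, check_UptoNinetySevenKinked_piece119⟩
  · exact Or.inr ⟨_, check_UptoNinetySevenKinked_piece120⟩
  · exact Or.inr ⟨_, check_UptoNinetySevenKinked_piece121⟩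
  · exact Or.inr ⟨_, check_UptoNinetySevenKinked_piece122⟩
  · exact Or.inr ⟨_, check_UptoNinetySevenKinked_piece123⟩
  · exact Or.inr ⟨_, check_UptoNinetySevenKinked_piece124⟩
  · exact Or.inr ⟨_, check_UptoNinetySevenKinked_piece125⟩
  · exact Or.inr ⟨_, check_UptoNinetySevenKinked_piece126⟩
  · exact Or.inr ⟨_, check_UptoNinetySevenKinked_piece127⟩
  · exact Or.inr ⟨_, check_UptoNinetySevenKinked_piece128⟩
  · exact Or.inr ⟨_, check_UptoNinetySevenKinked_piece129⟩
  · exact Or.inr ⟨_, check_UptoNinetySevenKinked_piece130⟩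
  · exact Or.inr ⟨_, check_UptoNinetySevenKinked_piece131⟩
  · exact Or.inr ⟨_, check_UptoNinetySevenKinked_piece132⟩
  · exact Or.inr ⟨_, check_UptoNinetySevenKinked_piece133⟩
  · exact Or.inr ⟨_, check_UptoNinetySevenKinked_piece134⟩
  · exact Or.inr ⟨_, check_UptoNinetySevenKinked_piece135⟩
  · exact Or.inr ⟨_, check_UptoNinetySevenKinked_piece136⟩
  · exact Or.inr ⟨_, check_UptoNinetySevenKinked_piece137⟩
  · exact Or.inr ⟨_, check_UptoNinetySevenKinked_piece138⟩
  · exact Or.inr ⟨_, check_UptoNinetySevenKinked_piece139⟩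
  · exact Or.inr ⟨_, check_UptoNinetySevenKinked_piece140⟩
  · exact Or.inr ⟨_, check_UptoNinetySevenKinked_piece141⟩
  · exact Or.inr ⟨_, check_UptoNinetySevenKinked_piece142⟩
  · exact Or.inr ⟨_, check_UptoNinetySevenKinked_piece143⟩
  · exact Or.inr ⟨_, check_UptoNinetySevenKinked_piece144⟩
  · exact Or.inr ⟨_, check_UptoNinetySevenKinked_piece145⟩
  · exact Or.inr ⟨_, check_UptoNinetySevenKinked_piece146⟩
  · exact Or.inr ⟨_, check_UptoNinetySevenKinked_piece147⟩
  · exact Or.inr ⟨_, check_UptoNinetySevenKinked_piece148⟩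
  · exact Or.inr ⟨_, check_UptoNinetySevenKinked_piece149⟩
  · exact Or.inr ⟨_, check_UptoNinetySevenKinked_piece150⟩
  · exact Or.inr ⟨_, check_UptoNinetySevenKinked_piece151⟩
  · exact Or.inr ⟨_, check_UptoNinetySevenKinked_piece152⟩
  · exact Or.inr ⟨_, check_UptoNinetySevenKinked_piece153⟩
  · exact Or.inr ⟨_, check_UptoNinetySevenKinked_piece154⟩
  · exact Or.inr ⟨_, check_UptoNinetySevenKinked_piece155⟩
  · exact Or.inr ⟨_, check_UptoNinetySevenKinked_piece156⟩
  · exact Or.inr ⟨_, check_UptoNinetySevenKinked_piece157⟩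
  · exact Or.inr ⟨_, check_UptoNinetySevenKinked_piece158⟩
  · exact Or.inr ⟨_, check_UptoNinetySevenKinked_piece159⟩
  · exact Or.inr ⟨_, check_UptoNinetySevenKinked_piece160⟩
  · exact Or.inr ⟨_, check_UptoNinetySevenKinked_piece161⟩
  · exact Or.inr ⟨_, check_UptoNinetySevenKinked_piece162⟩
  · exact Or.inr ⟨_, check_UptoNinetySevenKinked_piece163⟩
  · exact Or.inr ⟨_, check_UptoNinetySevenKinked_piece164⟩
  · exact Or.inr ⟨_, check_UptoNinetySevenKinked_piece165⟩
  · exact Or.inr ⟨_, check_UptoNinetySevenKinked_piece166⟩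
  · exact Or.inr ⟨_, check_UptoNinetySevenKinked_piece167⟩
  · exact Or.inr ⟨_, check_UptoNinetySevenKinked_piece168⟩
  · exact Or.inr ⟨_, check_UptoNinetySevenKinked_piece169⟩
  · exact Or.inr ⟨_, check_UptoNinetySevenKinked_piece170⟩
  · exact Or.inr ⟨_, check_UptoNinetySevenKinked_piece171⟩
  · exact Or.inr ⟨_, check_UptoNinetySevenKinked_piece172⟩
  · exact Or.inr ⟨_, check_UptoNinetySevenKinked_piece173⟩
  · exact Or.inr ⟨_, check_UptoNinetySevenKinked_piece174⟩
  · exact Or.inr ⟨_, check_UptoNinetySevenKinked_piece175⟩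
  · exact Or.inr ⟨_, check_UptoNinetySevenKinked_piece176⟩
  · exact Or.inr ⟨_, check_UptoNinetySevenKinked_piece177⟩
  · exact Or.inr ⟨_, check_UptoNinetySevenKinked_piece178⟩
  · exact Or.inr ⟨_, check_UptoNinetySevenKinked_piece179⟩
  · exact Or.inr ⟨_, check_UptoNinetySevenKinked_piece180⟩
  · exact Or.inr ⟨_, check_UptoNinetySevenKinked_piece181⟩
  · exact Or.inr ⟨_, check_UptoNinetySevenKinked_piece182⟩
  · exact Or.inr ⟨_, check_UptoNinetySevenKinked_piece183⟩
  · exact Or.inr ⟨_, check_UptoNinetySevenKinked_piece184⟩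
  · exact Or.inr ⟨_, check_UptoNinetySevenKinked_piece185⟩
  · exact Or.inr ⟨_, check_UptoNinetySevenKinked_piece186⟩
  · exact Or.inr ⟨_, check_UptoNinetySevenKinked_piece187⟩
  · exact Or.inr ⟨_, check_UptoNinetySevenKinked_piece188⟩
  · exact Or.inr ⟨_, check_UptoNinetySevenKinked_piece189⟩
  · exact Or.inr ⟨_, check_UptoNinetySevenKinked_piece190⟩
  · exact Or.inr ⟨_, check_UptoNinetySevenKinked_piece191⟩
  · exact Or.inr ⟨_, check_UptoNinetySevenKinked_piece192⟩
  · exact Or.inr ⟨_, check_UptoNinetySevenKinked_piece193⟩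
  · exact Or.inr ⟨_, check_UptoNinetySevenKinked_piece194⟩
  · exact Or.inr ⟨_, check_UptoNinetySevenKinked_piece195⟩
  · exact Or.inr ⟨_, check_UptoNinetySevenKinked_piece196⟩
  · exact Or.inr ⟨_, check_UptoNinetySevenKinked_piece197⟩
  · exact Or.inr ⟨_, check_UptoNinetySevenKinked_piece198⟩
  · exact Or.inr ⟨_, check_UptoNinetySevenKinked_piece199⟩
  · exact Or.inr ⟨_, check_UptoNinetySevenKinked_piece200⟩
  · exact Or.inr ⟨_, check_UptoNinetySevenKinked_piece201⟩
  · exact Or.inr ⟨_, check_UptoNinetySevenKinked_piece202⟩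
  · exact Or.inr ⟨_, check_UptoNinetySevenKinked_piece203⟩
  · exact Or.inr ⟨_, check_UptoNinetySevenKinked_piece204⟩
  · exact Or.inr ⟨_, check_UptoNinetySevenKinked_piece205⟩
  · exact Or.inr ⟨_, check_UptoNinetySevenKinked_piece206⟩
  · exact Or.inr ⟨_, check_UptoNinetySevenKinked_piece207⟩
  · exact Or.inr ⟨_, check_UptoNinetySevenKinked_piece208⟩
  · exact Or.inr ⟨_, check_UptoNinetySevenKinked_piece209⟩
  · exact Or.inr ⟨_, check_UptoNinetySevenKinked_piece210⟩
  · exact Or.inr ⟨_, check_UptoNinetySevenKinked_piece211⟩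
  · exact Or.inr ⟨_, check_UptoNinetySevenKinked_piece212⟩
  · exact Or.inr ⟨_, check_UptoNinetySevenKinked_piece213⟩
  · exact Or.inr ⟨_, check_UptoNinetySevenKinked_piece214⟩
  · exact Or.inr ⟨_, check_UptoNinetySevenKinked_piece215⟩
  · exact Or.inr ⟨_, check_UptoNinetySevenKinked_piece216⟩
  · exact Or.inr ⟨_, check_UptoNinetySevenKinked_piece217⟩
  · exact Or.inr ⟨_, check_UptoNinetySevenKinked_piece218⟩
  · exact Or.inr ⟨_, check_UptoNinetySevenKinked_piece219⟩
  · exact Or.inr ⟨_, check_UptoNinetySevenKinked_piece220⟩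
  · exact Or.inr ⟨_, check_UptoNinetySevenKinked_piece221⟩
  · exact Or.inr ⟨_, check_UptoNinetySevenKinked_piece222⟩
  · exact Or.inr ⟨_, check_UptoNinetySevenKinked_piece223⟩
  · exact Or.inr ⟨_, check_UptoNinetySevenKinked_piece224⟩
  · exact Or.inr ⟨_, check_UptoNinetySevenKinked_piece225⟩
  · exact Or.inr ⟨_, check_UptoNinetySevenKinked_piece226⟩
  · exact Or.inr ⟨_, check_UptoNinetySevenKinked_piece227⟩
  · exact Or.inr ⟨_, check_UptoNinetySevenKinked_piece228⟩
  · exact Or.inr ⟨_, check_UptoNinetySevenKinked_piece229⟩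
  · exact Or.inr ⟨_, check_UptoNinetySevenKinked_piece230⟩
  · exact Or.inr ⟨_, check_UptoNinetySevenKinked_piece231⟩
  · exact Or.inr ⟨_, check_UptoNinetySevenKinked_piece232⟩
  · exact Or.inr ⟨_, check_UptoNinetySevenKinked_piece233⟩
  · exact Or.inr ⟨_, check_UptoNinetySevenKinked_piece234⟩
  · exact Or.inr ⟨_, check_UptoNinetySevenKinked_piece235⟩
  · exact Or.inr ⟨_, check_UptoNinetySevenKinked_piece236⟩
  · exact Or.inr ⟨_, check_UptoNinetySevenKinked_piece237⟩
  · exact Or.inr ⟨_, check_UptoNinetySevenKinked_piece238⟩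
  · exact Or.inr ⟨_, check_UptoNinetySevenKinked_piece239⟩
  · exact Or.inr ⟨_, check_UptoNinetySevenKinked_piece240⟩
  · exact Or.inr ⟨_, check_UptoNinetySevenKinked_piece241⟩
  · exact Or.inr ⟨_, check_UptoNinetySevenKinked_piece242⟩
  · exact Or.inr ⟨_, check_UptoNinetySevenKinked_piece243⟩

end Summit.RiemannHypothesis.RiemannHypothesis.Theorems.SemilocalPolyWitness

end
-- 2026-08-26T12:4xZ weil-1 gen20: byte-identical re-land to refresh the stranded hub olean (gate5 build-queue workaround; director-rh 12:16:38Z); no content change.
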